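import Summits.QuantumFields.BalabanUV.Beta.GAN24.DiagramDecayTorus
import Summits.QuantumFields.BalabanUV.Beta.GAN24.DiagramDecayZdSocket
import Summits.QuantumFields.BalabanUV.Beta.GAN24.InsertionChainDecayBalaban
import Literature.MathematicalPhysics.QuantumFieldTheory.Balaban1983to89.Beta.InfiniteVolumeRate

/-!
# `BalabanUV.Beta.GAN24.DiagramDecayWindow` — binder row G-an2-4 ∕ (CONV-C), route R7 «TWO CURRENCIES», PART 134: THE DICTIONARY FROM THE LINEAGE's TORUS CURRENCY TO THE β-CELL's
# WINDOW CURRENCY, AND THE END-TO-END STATEMENT.  On a CUBIC torus `M = (s,…,s)` the unit index set `idx L M 0` is read in the β-cell's `Site d s × Fin d` through NE2's `unitIdx`, the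
# sup-distance `distK` from the origin dominates the window ℓ¹-norm (`|windowMap z|₁ ≤ d·distK`), so (UD)+(SR) in the `distK` currency with constants free of the volume (PARTs 115–132)
# ARE the volume-uniform window bounds PART 133's socket consumes, with rate `δ∕d`.  Consequently (§3), for the EFFECTIVE FORM `Σ_k = (Q_k𝒢Q_kᴴ)⁻¹ − a·1` at `U = 1` read as torus
# kernels `P^{(k)}_t(z)_{μν} = Re Σ_k((z,μ),(0,ν))` on the cubic tori of sides `side t → ∞`: IF the infinite-volume limits `P^{(k)}_t → Π_k` exist at each scale (the β-cell's
# `IsInfiniteVolumeLimit` — the ONE displayed hypothesis), THEN `Π` satisfies the β-cell's `UniformDecay` and `StepRate` on `ℤ^d`, `KernelInputs d Π` is inhabited with `θ = √(L⁻¹)`, and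
# `|secondMoment (Π k) μ ν − secondMoment Π_∞ μ ν| ≤ c₀·(√(L⁻¹))^k` — the `conv` field of `Beta.Assembly.LimitForm` for these kernels — every other input a tree theorem (`d ≥ 2`, `L ≥ 2`,
# `a > 0`).  The same two lines serve ANY (UD)+(SR) tower of the lineage (the bubble, the tadpole, the dressed diagrams of PART 132, the insertion chains of PARTs 124–126)
# (unit b2b-balaban-gan24-p3, gen 53 v1; gen 54 v2 = v1 minus the duplicate `toM_eq_unitSites`, now imported from PART 126)

NOT IN PRINT; OUR PROOF ([folklore] bookkeeping BY NAME over NE2's `BalabanAveragedCoerciveTower.unitIdx ∕ unitSites ∕ val_unitSites`, `CTKingTowerWeights` (`distK`, `toM`, `val_toM`,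
`distK_comm`), the β-cell's `VectorTailsCov.tdist ∕ tdist_comm`, `VectorTails.liftZ`, `PoissonInterior.natAbs_le_supNorm`, `InfiniteVolumeRate.windowMap_apply_eq_valMinAbs`, PART 132
(`decay_effForm`), PART 133 (`stepRate_of_isInfiniteVolumeLimit`, `uniformDecay_of_isInfiniteVolumeLimit`, `exists_kernelInputs_of_volumeUniform`, `abs_secondMoment_sub_le_of_volumeUniform`);
[Balaban1987RG1] (1.21)–(1.22) p. 264 locate the SHAPES; nothing printed is a hypothesis).
HONEST FRAMING (cell contract, verbatim): «discharging `BetaPertH` makes Bałaban's UV stability UNCONDITIONAL — a real constructive-QFT result; it is NOT the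
continuum limit and NOT the Clay problem.»  HONEST DEPENDENCY (verbatim): «continuum YM on T⁴ ⇐ BetaPertH ∧ nine spine estimates (0/9 proved); BetaPertH ⇐
(D1) ∧ (D4) ∧ CAP+tail; G-an2-4 gates asym, D1 and NE2/3/4.»

WHAT THIS FILE PROVES (0 sorry, 0 `def`; cubic torus `M = fun _ : Fin d => s`, `e = (unitIdx L M).symm : Site d s × Fin d ≃ idx L M 0`):
* §1 (`toM_eq_unitSites` is PART 126's, imported) `distK_unitIdx_symm` (`distK (e(z,μ)) (e(z′,ν)) = tdist z z′`), **`l1_windowMap_le`** (`|windowMap z|₁ ≤ d·tdist z 0`),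
  `exp_distK_le_exp_window` (`e^{−δ·distK(e(z,μ),e(0,ν))} ≤ e^{−(δ∕d)|windowMap z|₁}`, `δ ≥ 0`).
* §2 **`window_bounds_of_decay`** — THE DICTIONARY: (UD) `∀ k, EntryDecay distK (c k) B δ` and (SR) `TwoLevelDecayRate distK c B′ δ θ` on `idx L M 0` ⟹ for the REAL PARTS of the entries read from
  the origin, `|Re c_k(e(z,μ),e(0,ν))| ≤ B·e^{−(δ∕d)|windowMap z|₁}` and `|Re c_{k+1}(…) − Re c_k(…)| ≤ B′θ^k·e^{−(δ∕d)|windowMap z|₁}` — the volume-uniform window bounds of PART 133 (the same for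
  imaginary parts, `window_bounds_of_decay_im`).
* §3 **`kernelInputs_effForm_of_isInfiniteVolumeLimit`** ∕ **`conv_effForm_of_isInfiniteVolumeLimit`** — THE END-TO-END STATEMENT for `Σ_k` (`L ≥ 2`, `d ≥ 2`, `μ ≠ ν`): `∃ δ₀ > 0, C, C′ ≥ 0` (from
  `(d, L, a)` only) such that for EVERY sequence of cubic tori `side t → ∞` and every family of limit kernels `Π` with `∀ k, IsInfiniteVolumeLimit side (P k) (Π k)` (HYPOTHESIS), where
  `P k t μ ν z = Re Σ^{(t)}_k(e(z,μ), e(0,ν))`: `Beta.LimitRate.UniformDecay Π μ ν C δ₀`, `StepRate Π μ ν C′ δ₀ (√(L⁻¹))`, `∃ K : KernelInputs d Π` with `K.θ = √(L⁻¹)`, and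
  `∀ k, |secondMoment (Π k) μ ν − secondMoment (limKernelOf Π) μ ν| ≤ β′_d(C′∕(1−√(L⁻¹)), δ₀)·(√(L⁻¹))^k`.
WHAT IT DOES NOT DO: prove `IsInfiniteVolumeLimit` for `Σ_k` (located tool: the β-cell's `EntrywiseVolumeLimit` for block-periodic inverses — not invoked; the displayed hypothesis); identify
`Σ_k` or any diagram of it with Bałaban's `Π⁰_{k+1}` (row an1's dictionary); `U ≠ 1`.  SUPPLIER work; no consumer of record; NEVER «G-an2-4 closed»; NOT (CONV-C), NOT D1, NOT `BetaPertH`, NOT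
continuum, NOT Clay.  Records: `HOME/b2b-balaban-gan24-p3/gen53/README.md`.
-/

noncomputable section

open scoped BigOperators ComplexConjugate Matrix Matrix.Norms.L2Operator
open Filter Topology

namespace Summit.QuantumFields.BalabanUV.Beta.GAN24.DiagramDecayWindow

open Literature.MathematicalPhysics.QuantumFieldTheory.Balaban1983to89
open Literature.MathematicalPhysics.QuantumFieldTheory.Balaban1983to89.B5Prop11Plancherel (Tor fine)
open Literature.MathematicalPhysics.QuantumFieldTheory.Balaban1983to89.B5G183RateUnitTower (lev)
open Literature.MathematicalPhysics.QuantumFieldTheory.Balaban1983to89.B12Sec2to5 (l1 betaPrime510)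
open Literature.MathematicalPhysics.QuantumFieldTheory.Balaban1983to89.Beta (Site windowMap IsInfiniteVolumeLimit)
open Literature.MathematicalPhysics.QuantumFieldTheory.Balaban1983to89.Beta.VectorTailsCov (tdist tdist_comm)
open Literature.MathematicalPhysics.QuantumFieldTheory.Balaban1983to89.Beta.VectorTails (liftZ)
open Literature.MathematicalPhysics.QuantumFieldTheory.Balaban1983to89.Beta.PoissonInterior (supNorm natAbs_le_supNorm)
open Literature.MathematicalPhysics.QuantumFieldTheory.Balaban1983to89.Beta.LimitRate (StepRate limKernelOf KernelInputs)
open Summit.QuantumFields.BalabanUV.T4Continuum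
open Summit.QuantumFields.BalabanUV.T4Continuum.BalabanAveragedTowerUnit (idx unitCovB)
open Summit.QuantumFields.BalabanUV.T4Continuum.BalabanAveragedCoerciveTower (unitSites val_unitSites unitIdx unitIdx_apply)
open Summit.QuantumFields.BalabanUV.T4Continuum.CTKingTowerWeights (toM val_toM distK distK_comm)
open Summit.QuantumFields.BalabanUV.T4Continuum.DecayRateInterpolation (EntryDecay TwoLevelDecayRate)
open Summit.QuantumFields.BalabanUV.Beta.GAN24.DiagramDecayTorus (decay_effForm)
open Summit.QuantumFields.BalabanUV.Beta.GAN24.InsertionChainDecayBalaban (toM_eq_unitSites)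
open Summit.QuantumFields.BalabanUV.Beta.GAN24.DiagramDecayZdSocket (stepRate_of_isInfiniteVolumeLimit uniformDecay_of_isInfiniteVolumeLimit
  exists_kernelInputs_of_volumeUniform abs_secondMoment_sub_le_of_volumeUniform)

variable {d : ℕ} (L : ℕ) [NeZero L]

/-! ## §1 The two readings of the unit lattice agree; `distK` from the origin dominates the window ℓ¹-norm -/

section Reading

variable (M : Fin d → ℕ) [hM : ∀ μ, NeZero (M μ)]

/-- `distK` read through `unitIdx⁻¹` is the torus sup-distance of the sites. [folklore] -/
theorem distK_unitIdx_symm (z z' : Tor M) (μ ν : Fin d) : distK L M ((unitIdx L M).symm (z, μ)) ((unitIdx L M).symm (z', ν)) = (tdist z z' : ℝ) := by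
  have h : ∀ (w : Tor M) (κ : Fin d), toM L M ((unitIdx L M).symm (w, κ)).1 = w := fun w κ => by
    rw [toM_eq_unitSites]
    have e := (unitIdx L M).apply_symm_apply (w, κ)
    rw [unitIdx_apply] at e
    exact congrArg Prod.fst e
  unfold distK; rw [h, h]

end Reading

/-- **the window ℓ¹-norm is dominated by the torus sup-distance from the origin**: `|windowMap z|₁ ≤ d·tdist z 0` on the cubic torus `(ℤ∕s)^d` (coordinatewise `|valMinAbs| ≤ sup`). [folklore] -/
theorem l1_windowMap_le (s : ℕ) [NeZero s] (z : Site d s) : l1 (windowMap d s z) ≤ d * (tdist (N := fun _ : Fin d => s) z 0 : ℝ) := by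
  have hco : ∀ i, |(windowMap d s z i : ℝ)| ≤ (tdist (N := fun _ : Fin d => s) z 0 : ℝ) := by
    intro i
    rw [tdist_comm, Beta.windowMap_apply_eq_valMinAbs]
    have h : ((z i).valMinAbs).natAbs ≤ tdist (N := fun _ : Fin d => s) 0 z := by
      unfold tdist
      have e : (liftZ (N := fun _ : Fin d => s) (z - 0)) i = (z i).valMinAbs := by simp [liftZ]
      have := natAbs_le_supNorm (liftZ (N := fun _ : Fin d => s) (z - 0)) i
      rwa [e] at this
    have h' : (((z i).valMinAbs).natAbs : ℝ) ≤ (tdist (N := fun _ : Fin d => s) 0 z : ℝ) := by exact_mod_cast h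
    rwa [Nat.cast_natAbs, Int.cast_abs] at h'
  calc l1 (windowMap d s z) = ∑ i, |(windowMap d s z i : ℝ)| := rfl
    _ ≤ ∑ _i : Fin d, (tdist (N := fun _ : Fin d => s) z 0 : ℝ) := Finset.sum_le_sum fun i _ => hco i
    _ = d * (tdist (N := fun _ : Fin d => s) z 0 : ℝ) := by rw [Finset.sum_const, Finset.card_univ, Fintype.card_fin, nsmul_eq_mul]

/-- the exponential form: `e^{−δ·distK(e(z,μ), e(0,ν))} ≤ e^{−(δ∕d)·|windowMap z|₁}` for `δ ≥ 0`. [folklore] -/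
theorem exp_distK_le_exp_window (s : ℕ) [NeZero s] {δ : ℝ} (hδ : 0 ≤ δ) (z : Site d s) (μ ν : Fin d) :
    Real.exp (-(δ * distK L (fun _ : Fin d => s) ((unitIdx L (fun _ : Fin d => s)).symm (z, μ)) ((unitIdx L (fun _ : Fin d => s)).symm (0, ν)))) ≤ Real.exp (-(δ / d) * l1 (windowMap d s z)) := by
  rw [distK_unitIdx_symm]
  refine Real.exp_le_exp.mpr ?_
  rcases Nat.eq_zero_or_pos d with hd | hd
  · subst hd; simp
  have hdR : (0 : ℝ) < d := by exact_mod_cast hd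
  have h := l1_windowMap_le (d := d) s z
  have : δ / d * l1 (windowMap d s z) ≤ δ * (tdist (N := fun _ : Fin d => s) z 0 : ℝ) := by
    rw [div_mul_eq_mul_div, div_le_iff₀ hdR]
    calc δ * l1 (windowMap d s z) ≤ δ * (d * (tdist (N := fun _ : Fin d => s) z 0 : ℝ)) := mul_le_mul_of_nonneg_left h hδ
      _ = δ * (tdist (N := fun _ : Fin d => s) z 0 : ℝ) * d := by ring
  linarith

/-! ## §2 The dictionary: (UD)+(SR) in the `distK` currency ⟹ volume-uniform window bounds -/

/-- **`window_bounds_of_decay` — THE DICTIONARY** [folklore]: on the cubic torus `M = (s,…,s)`, (UD) `∀ k, EntryDecay distK (c k) B δ` and (SR) `TwoLevelDecayRate distK c B′ δ θ` (`δ ≥ 0`) give, for the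
REAL PARTS of the entries read from the origin through `e = unitIdx⁻¹`, `|Re c_k(e(z,μ),e(0,ν))| ≤ B·e^{−(δ∕d)|windowMap z|₁}` and `|Re c_{k+1}(…) − Re c_k(…)| ≤ B′θ^k·e^{−(δ∕d)|windowMap z|₁}` —
exactly the volume-uniform hypotheses (UD)_vol ∕ (SR)_vol of PART 133 when `B, B′, δ, θ` are free of `s`. -/
theorem window_bounds_of_decay (s : ℕ) [NeZero s] {c : ℕ → Matrix (idx L (fun _ : Fin d => s) 0) (idx L (fun _ : Fin d => s) 0) ℂ} {B B' δ θ : ℝ} (hδ : 0 ≤ δ)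
    (hud : ∀ k, EntryDecay (distK L (fun _ : Fin d => s)) (c k) B δ) (hsr : TwoLevelDecayRate (distK L (fun _ : Fin d => s)) c B' δ θ) (μ ν : Fin d) :
    (∀ k (z : Site d s), |(c k ((unitIdx L (fun _ : Fin d => s)).symm (z, μ)) ((unitIdx L (fun _ : Fin d => s)).symm (0, ν))).re| ≤ B * Real.exp (-(δ / d) * l1 (windowMap d s z))) ∧
    (∀ k (z : Site d s), |(c (k + 1) ((unitIdx L (fun _ : Fin d => s)).symm (z, μ)) ((unitIdx L (fun _ : Fin d => s)).symm (0, ν))).re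
        - (c k ((unitIdx L (fun _ : Fin d => s)).symm (z, μ)) ((unitIdx L (fun _ : Fin d => s)).symm (0, ν))).re| ≤ B' * θ ^ k * Real.exp (-(δ / d) * l1 (windowMap d s z))) := by
  have hB : 0 ≤ B := by
    have := (norm_nonneg _).trans (hud 0 ((unitIdx L (fun _ : Fin d => s)).symm (0, μ)) ((unitIdx L (fun _ : Fin d => s)).symm (0, μ)))
    exact nonneg_of_mul_nonneg_left this (Real.exp_pos _)
  refine ⟨fun k z => ?_, fun k z => ?_⟩
  · have h := hud k ((unitIdx L (fun _ : Fin d => s)).symm (z, μ)) ((unitIdx L (fun _ : Fin d => s)).symm (0, ν))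
    refine ((Complex.abs_re_le_norm _).trans h).trans ?_
    exact mul_le_mul_of_nonneg_left (exp_distK_le_exp_window L s hδ z μ ν) hB
  · have h := hsr k ((unitIdx L (fun _ : Fin d => s)).symm (z, μ)) ((unitIdx L (fun _ : Fin d => s)).symm (0, ν))
    have hBk : 0 ≤ B' * θ ^ k := nonneg_of_mul_nonneg_left ((norm_nonneg _).trans h) (Real.exp_pos _)
    rw [Matrix.sub_apply] at h
    rw [← Complex.sub_re]
    refine ((Complex.abs_re_le_norm _).trans h).trans ?_
    exact mul_le_mul_of_nonneg_left (exp_distK_le_exp_window L s hδ z μ ν) hBk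

/-! ## §3 The end-to-end statement for the effective form at `U = 1`, modulo the infinite-volume limits -/

variable (a : ℝ) (ha : 0 < a)

/-- **`conv_effForm_of_isInfiniteVolumeLimit` — `LimitForm.conv`'s CLAUSE ON `ℤ^d` FOR THE EFFECTIVE FORM, MODULO ONLY THE INFINITE-VOLUME LIMITS** [our proof] (`L ≥ 2`, `d ≥ 2`, `μ ≠ ν`):
there are `δ₀ > 0` and `C, C′ ≥ 0` depending on `(d, L, a)` only such that for EVERY sequence of cubic torus sides `side t → ∞` and EVERY family `Π : ℕ → B12Beta.Kernel d` with
`∀ k, IsInfiniteVolumeLimit side (P k) (Π k)` — `P k t μ ν z = Re Σ^{(side t)}_k(e(z,μ), e(0,ν))`, `Σ_k = (unitCovB k)⁻¹ − a·1` (PART 128's END object) — one has the β-cell's two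
kernel-level inputs `Beta.LimitRate.UniformDecay Π μ ν C δ₀` and `StepRate Π μ ν C′ δ₀ (√(L⁻¹))`, an inhabitant `K : KernelInputs d Π` with `K.θ = √(L⁻¹)`, and the (AF-0r) clause
`∀ k, |secondMoment (Π k) μ ν − secondMoment (limKernelOf Π) μ ν| ≤ β′_d(C′∕(1−√(L⁻¹)), δ₀)·(√(L⁻¹))^k`.  The volume limits are the ONE displayed hypothesis; everything else is a tree theorem.
[cite: Balaban1987RG1, (1.21)–(1.22) p.264 (shapes)] -/
theorem conv_effForm_of_isInfiniteVolumeLimit (hL : 2 ≤ L) (hd : 2 ≤ d) {μ ν : Fin d} (hne : μ ≠ ν) :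
    ∃ δ₀ C C' : ℝ, 0 < δ₀ ∧ 0 ≤ C ∧ 0 ≤ C' ∧ ∀ (side : ℕ → ℕ) [∀ t, NeZero (side t)], Tendsto side atTop atTop →
      ∀ (Pinf : ℕ → B12Beta.Kernel d),
      (∀ k, IsInfiniteVolumeLimit side
        (fun t μ' ν' (z : Site d (side t)) => (((unitCovB L (fun _ : Fin d => side t) a ha k)⁻¹ - (a : ℂ) • (1 : Matrix (idx L (fun _ : Fin d => side t) 0) (idx L (fun _ : Fin d => side t) 0) ℂ))
          ((unitIdx L (fun _ : Fin d => side t)).symm (z, μ')) ((unitIdx L (fun _ : Fin d => side t)).symm (0, ν'))).re) (Pinf k)) →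
      Beta.LimitRate.UniformDecay Pinf μ ν C δ₀ ∧ StepRate Pinf μ ν C' δ₀ (Real.sqrt ((L : ℝ)⁻¹)) ∧
      (∃ K : KernelInputs d Pinf, K.θ = Real.sqrt ((L : ℝ)⁻¹) ∧ K.c₀ = betaPrime510 d (C' / (1 - Real.sqrt ((L : ℝ)⁻¹))) δ₀ ∧ K.Pinf = limKernelOf Pinf ∧ K.μ = μ ∧ K.ν = ν) ∧
      (∀ k, |B12Beta.secondMoment (Pinf k) μ ν - B12Beta.secondMoment (limKernelOf Pinf) μ ν|
          ≤ betaPrime510 d (C' / (1 - Real.sqrt ((L : ℝ)⁻¹))) δ₀ * Real.sqrt ((L : ℝ)⁻¹) ^ k) := by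
  obtain ⟨κ', Bs, Bs', hκ', hBs, hBs', h⟩ := decay_effForm L a ha hL hd
  have hd0 : (0 : ℝ) < d := by exact_mod_cast lt_of_lt_of_le two_pos hd
  have hL1 : (1 : ℝ) < L := by exact_mod_cast (lt_of_lt_of_le one_lt_two hL : 1 < L)
  have hθ0 : 0 ≤ Real.sqrt ((L : ℝ)⁻¹) := Real.sqrt_nonneg _
  have hθ1 : Real.sqrt ((L : ℝ)⁻¹) < 1 := by
    rw [show (1 : ℝ) = Real.sqrt 1 from Real.sqrt_one.symm]
    exact Real.sqrt_lt_sqrt (inv_nonneg.mpr (Nat.cast_nonneg _)) (inv_lt_one_of_one_lt₀ hL1)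
  refine ⟨κ' / d, Bs, Bs', div_pos hκ' hd0, hBs, hBs', fun side _ hside Pinf hlim => ?_⟩
  -- the volume-uniform window bounds, torus by torus, from the dictionary
  have hUDv : ∀ k, Beta.UniformDecay side (fun t μ' ν' (z : Site d (side t)) =>
      (((unitCovB L (fun _ : Fin d => side t) a ha k)⁻¹ - (a : ℂ) • (1 : Matrix (idx L (fun _ : Fin d => side t) 0) (idx L (fun _ : Fin d => side t) 0) ℂ))
        ((unitIdx L (fun _ : Fin d => side t)).symm (z, μ')) ((unitIdx L (fun _ : Fin d => side t)).symm (0, ν'))).re) Bs (κ' / d) := by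
    intro k t μ' ν' z
    have := (window_bounds_of_decay L (side t) hκ'.le (h (fun _ : Fin d => side t)).1 (h (fun _ : Fin d => side t)).2 μ' ν').1 k z
    simpa only [neg_mul] using this
  have hSRv : ∀ k t (z : Site d (side t)),
      |(((unitCovB L (fun _ : Fin d => side t) a ha (k + 1))⁻¹ - (a : ℂ) • (1 : Matrix (idx L (fun _ : Fin d => side t) 0) (idx L (fun _ : Fin d => side t) 0) ℂ))
          ((unitIdx L (fun _ : Fin d => side t)).symm (z, μ)) ((unitIdx L (fun _ : Fin d => side t)).symm (0, ν))).re
        - (((unitCovB L (fun _ : Fin d => side t) a ha k)⁻¹ - (a : ℂ) • (1 : Matrix (idx L (fun _ : Fin d => side t) 0) (idx L (fun _ : Fin d => side t) 0) ℂ))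
          ((unitIdx L (fun _ : Fin d => side t)).symm (z, μ)) ((unitIdx L (fun _ : Fin d => side t)).symm (0, ν))).re|
        ≤ Bs' * Real.sqrt ((L : ℝ)⁻¹) ^ k * Real.exp (-(κ' / d) * l1 (windowMap d (side t) z)) :=
    fun k t z => (window_bounds_of_decay L (side t) hκ'.le (h (fun _ : Fin d => side t)).1 (h (fun _ : Fin d => side t)).2 μ ν).2 k z
  refine ⟨uniformDecay_of_isInfiniteVolumeLimit hside hlim hUDv μ ν, stepRate_of_isInfiniteVolumeLimit hside hlim hSRv,
    exists_kernelInputs_of_volumeUniform hside hlim hne (div_pos hκ' hd0) (div_pos hκ' hd0) hθ0 hθ1 hUDv hSRv,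
    abs_secondMoment_sub_le_of_volumeUniform hside hlim hne (div_pos hκ' hd0) (div_pos hκ' hd0) hθ0 hθ1 hUDv hSRv⟩

end Summit.QuantumFields.BalabanUV.Beta.GAN24.DiagramDecayWindow

end
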